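import Literature.IUT.LogThetaLattice.ThetaPilotObjectsProp37iiProofs
import Mathlib.Topology.Algebra.Valued.NormedValued
import Mathlib.Analysis.SpecialFunctions.Log.Basic
import HarnessLib

/-!
# [IUTchIII] Example 3.6 (ii) at the model of a NONARCHIMEDEAN place: the local fractional ideals
# `𝔍_v = λ·𝒪_{K_v} ⊆ K_v` as literal subsets, "every finitely generated nonzero `𝒪_{K_v}`-submodule of `K_v`
# is of this form", and the dictionary `𝔍_v ↔ [λ] ∈ Γ_v = K_v^×/𝒪^×_{K_v}` PROVED

Proof-only companion (abc-iut cell, layer L6, wave-4 discharge seat abc-iut-w4-d013 gen 3; nodes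
IUTchIII:Ex3.6(ii) [bucket verify] / IUTchIII:Prop3.7(ii)) of abc-iut-L6-t6's `GlobalFrobenioidModels.lean`,
whose module docstring RECORDS the dictionary on which the whole model `FrakCat` of `𝓕⊛_𝔪𝔬𝔡` rests:

> "A local fractional ideal `𝔍_v = λ · 𝒪_{K_v}` (nonarchimedean: every nonzero finitely generated
> `𝒪_{K_v}`-submodule of `K_v` is of this form; archimedean: 'a positive real multiple of `𝒪_{K_v}`') is the same
> thing as the class `[λ] ∈ Γ_v`, and `f · 𝔍_{1,v} ⊆ 𝔍_{2,v}` ⟺ `β_v(f) + [λ₁] - [λ₂] ∈ Γ_v^{≥0}`"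

(`Γ_v := K_v^×/𝒪^×_{K_v}` additively, `β_v` "determined by the valuation on `K_v`"). HERE the nonarchimedean
half is PROVED for the literal subsets of a valued field (the archimedean half is the sibling
`ThetaPilotObjectsProp37iiArchProofs.lean`, same seat). NO new definitions: the model of a nonarchimedean
`K_v` is ANY nontrivially normed field `K` with `𝒪_{K_v} := {‖x‖ ≤ 1}` (= abc-iut-w4-d005's convention in
`ThetaPilotObjectsProp37iiProofs.lean`; for the finitely-generated clause `K` is ultrametric and `𝒪_{K_v}` is
Mathlib's valuation subring `NormedField.valuation.integer = {‖x‖ ≤ 1}` so that "`𝒪_{K_v}`-submodule" is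
literal); the class `[λ] ∈ Γ_v` is read through `‖λ‖` (the value group), `Γ_v^{≥0}` through `‖·‖ ≤ 1`, and in
`−log`-coordinates (abc-iut-L6-d1's `betaModel`, `Γ_v = ℝ ⊇ ℝ_{≥0}`).

S. Mochizuki, *Inter-universal Teichmüller Theory III*, kurims manuscript (May 2020), Example 3.6 (ii)
p. 107 l. 57–64, p. 108 l. 1–3 (cell render `lit/renders/IUTchIII-kurims-url-4b091feeb646`) [claim key
Mochizuki2012, status disputed (D-0012)]: "a finitely generated nonzero `𝒪_{K_v}`-submodule of `K_v` when
`v ∈ 𝕍^non`"; "`f·𝔍 = {f·𝔍_v}`"; "the `n`-th tensor power `𝔍^{⊗n}`"; an elementary morphism is "an element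
`f ∈ F^×_mod` that is integral with respect to `𝔍₁` and `𝔍₂` in the sense that `f·𝔍_{1,v} ⊆ 𝔍_{2,v}`".

WHAT IS PROVED (`𝒪 := closedBall 0 1 ⊆ K`, `λ, λ₁, λ₂ ∈ K^×`, `f ∈ K`):
* `smul_unitBall_eq_closedBall` (`λ·𝒪 = {‖z‖ ≤ ‖λ‖}`), `unit_smul_unitBall` (`u·𝒪 = 𝒪` for `‖u‖ = 1`: the class
  of `𝔍_v` lives in `K^×/𝒪^×`), `smul_unitBall_eq_iff` (`λ₁𝒪 = λ₂𝒪 ⟺ ‖λ₁‖ = ‖λ₂‖`: **"`𝔍_v = λ·𝒪_{K_v}` is the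
  same thing as the class `[λ] ∈ Γ_v`"**), `smul_smul_unitBall` (`f·(λ𝒪) = (fλ)𝒪`), `smul_unitBall_mul`
  (`(λ₁𝒪)·(λ₂𝒪) = (λ₁λ₂)𝒪`: tensor powers/products ↔ the group law of `Γ_v`);
* **`smul_smul_unitBall_subset_iff`** — `f·(λ₁𝒪) ⊆ λ₂𝒪 ⟺ ‖f‖·‖λ₁‖ ≤ ‖λ₂‖`, and
  **`smul_smul_unitBall_subset_iff_log`** — ⟺ `0 ≤ −log ‖f‖ + (−log ‖λ₁‖) − (−log ‖λ₂‖)` (`f ≠ 0`) = **"`f·𝔍_{1,v} ⊆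
  𝔍_{2,v}` ⟺ `β_v(f) + [λ₁] − [λ₂] ∈ Γ_v^{≥0}`"** in abc-iut-L6-d1's `ℝ`-coordinates;
* ultrametric `K` (additive closure of `λ𝒪` and `𝒪`-stability are abc-iut-w4-d005's `add_mem_smul_closedBall` /
  `mul_mem_smul_closedBall`, imported, not restated): `coe_span_singleton_eq_smul_unitBall` (`𝒪·λ = λ·𝒪` as subsets of `K`), and
  **`exists_eq_smul_unitBall_of_fg`** — EVERY finitely generated nonzero `𝒪_{K_v}`-submodule `J ⊆ K_v` is
  `λ·𝒪_{K_v}` for some `λ ≠ 0` (a generator of maximal absolute value generates: valuation rings are Bézout),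
  with converse `fg_submodule_iff_smul_unitBall` (the objects at `v ∈ 𝕍^non` are EXACTLY the `λ·𝒪_{K_v}`).

HONEST SCOPE: one place; the identification of `‖·‖`-classes with abc-iut-w4-d005's INTEGRAL `Γ_v = ℤ`
(`Prop37.beta = ord_v`) at a finite place of a number field is the standard `‖x‖_v = N(v)^{−ord_v x}`
normalisation of the tree's completion files and is not repeated here. Nothing in this file takes a side on
[IUTchIII] Cor. 3.12; typed ≠ discharged elsewhere; what is proved is classical valuation theory.
-/

noncomputable section

namespace Literature.IUT.LogThetaLattice

namespace LocalFracIdeal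

open Set Metric
open scoped Pointwise NNReal

section NormedField

variable {K : Type*} [NontriviallyNormedField K]

/-- `λ·𝒪_{K_v}` is the closed ball of radius `‖λ‖` (`λ ≠ 0`). [claim: Mochizuki2012, status: disputed] -/
theorem smul_unitBall_eq_closedBall {lam : K} (hlam : lam ≠ 0) :
    lam • closedBall (0 : K) 1 = closedBall (0 : K) ‖lam‖ := by
  ext z
  rw [mem_closedBall, dist_zero_right]
  constructor
  · intro hz
    obtain ⟨a, ha, rfl⟩ := mem_smul_set.mp hz
    rw [mem_closedBall, dist_zero_right] at ha
    rw [smul_eq_mul, norm_mul]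
    exact mul_le_of_le_one_right (norm_nonneg lam) ha
  · intro hz
    refine mem_smul_set.mpr ⟨lam⁻¹ * z, ?_, by rw [smul_eq_mul, ← mul_assoc, mul_inv_cancel₀ hlam, one_mul]⟩
    rw [mem_closedBall, dist_zero_right, norm_mul, norm_inv, inv_mul_le_iff₀ (norm_pos_iff.mpr hlam), mul_one]
    exact hz

/-- Membership in `λ·𝒪_{K_v}` (`λ ≠ 0`): `‖z‖ ≤ ‖λ‖`. [claim: Mochizuki2012, status: disputed] -/
theorem mem_smul_unitBall_iff {lam : K} (hlam : lam ≠ 0) {z : K} :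
    z ∈ lam • closedBall (0 : K) 1 ↔ ‖z‖ ≤ ‖lam‖ := by
  rw [smul_unitBall_eq_closedBall hlam, mem_closedBall, dist_zero_right]

/-- **The units `𝒪^×_{K_v}` act trivially: `u·𝒪_{K_v} = 𝒪_{K_v}` for `‖u‖ = 1`** — so the set `λ·𝒪_{K_v}` depends
on `λ` only through its class in `Γ_v = K_v^×/𝒪^×_{K_v}`. [claim: Mochizuki2012, status: disputed] -/
theorem unit_smul_unitBall {u : K} (hu : ‖u‖ = 1) : u • closedBall (0 : K) 1 = closedBall (0 : K) 1 := by
  have hu0 : u ≠ 0 := fun h => by simp [h] at hu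
  rw [smul_unitBall_eq_closedBall hu0, hu]

/-- **"`𝔍_v = λ·𝒪_{K_v}` is the same thing as the class `[λ] ∈ Γ_v`"**: `λ₁·𝒪 = λ₂·𝒪 ⟺ ‖λ₁‖ = ‖λ₂‖`
(`⟺ λ₁λ₂⁻¹ ∈ 𝒪^×`). [claim: Mochizuki2012, status: disputed] -/
theorem smul_unitBall_eq_iff {lam₁ lam₂ : K} (h₁ : lam₁ ≠ 0) (h₂ : lam₂ ≠ 0) :
    lam₁ • closedBall (0 : K) 1 = lam₂ • closedBall (0 : K) 1 ↔ ‖lam₁‖ = ‖lam₂‖ := by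
  constructor
  · intro h
    apply le_antisymm
    · exact (mem_smul_unitBall_iff h₂).mp (h ▸ self_mem_smul_closedBall lam₁)
    · exact (mem_smul_unitBall_iff h₁).mp (h.symm ▸ self_mem_smul_closedBall lam₂)
  · intro h
    rw [smul_unitBall_eq_closedBall h₁, smul_unitBall_eq_closedBall h₂, h]

/-- The class criterion in multiplicative form: `λ₁·𝒪 = λ₂·𝒪 ⟺ ‖λ₁ λ₂⁻¹‖ = 1` (the quotient is a unit).
[claim: Mochizuki2012, status: disputed] -/
theorem smul_unitBall_eq_iff_norm_div_eq_one {lam₁ lam₂ : K} (h₁ : lam₁ ≠ 0) (h₂ : lam₂ ≠ 0) :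
    lam₁ • closedBall (0 : K) 1 = lam₂ • closedBall (0 : K) 1 ↔ ‖lam₁ * lam₂⁻¹‖ = 1 := by
  rw [smul_unitBall_eq_iff h₁ h₂, norm_mul, norm_inv, mul_inv_eq_one₀ (norm_ne_zero_iff.mpr h₂)]

/-- **[IUTchIII] Ex. 3.6 (ii), "`f·𝔍 = {f·𝔍_v}`"**: `f·(λ·𝒪_{K_v}) = (fλ)·𝒪_{K_v}` (class `β_v(f) + [λ]`).
[claim: Mochizuki2012, status: disputed] -/
theorem smul_smul_unitBall (f lam : K) : f • (lam • closedBall (0 : K) 1) = (f * lam) • closedBall (0 : K) 1 :=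
  smul_smul f lam _

/-- **[IUTchIII] Ex. 3.6 (ii) elementary morphisms: "`f` integral with respect to `𝔍₁` and `𝔍₂` in the sense that
`f·𝔍_{1,v} ⊆ 𝔍_{2,v}`" ⟺ `‖f‖·‖λ₁‖ ≤ ‖λ₂‖`.** [claim: Mochizuki2012, status: disputed] -/
theorem smul_smul_unitBall_subset_iff (f : K) {lam₁ lam₂ : K} (h₁ : lam₁ ≠ 0) (h₂ : lam₂ ≠ 0) :
    f • (lam₁ • closedBall (0 : K) 1) ⊆ lam₂ • closedBall (0 : K) 1 ↔ ‖f‖ * ‖lam₁‖ ≤ ‖lam₂‖ := by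
  constructor
  · intro h
    have hmem := h (smul_mem_smul_set (a := f) (self_mem_smul_closedBall lam₁))
    rw [mem_smul_unitBall_iff h₂, smul_eq_mul, norm_mul] at hmem
    exact hmem
  · intro h z hz
    rw [smul_smul_unitBall] at hz
    rcases eq_or_ne f 0 with rfl | hf
    · rw [zero_mul] at hz
      obtain ⟨a, -, rfl⟩ := mem_smul_set.mp hz
      rw [zero_smul]
      exact (mem_smul_unitBall_iff h₂).mpr (by rw [norm_zero]; exact norm_nonneg _)
    · rw [mem_smul_unitBall_iff (mul_ne_zero hf h₁), norm_mul] at hz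
      exact (mem_smul_unitBall_iff h₂).mpr (hz.trans h)

/-- **The dictionary in `Γ_v`-coordinates: `f·𝔍_{1,v} ⊆ 𝔍_{2,v}` ⟺ `β_v(f) + [λ₁] − [λ₂] ∈ Γ_v^{≥0}`** with
`β_v = −log ‖·‖`, `[λ] = −log ‖λ‖`, `Γ_v^{≥0} ↔ 0 ≤ ·` (abc-iut-L6-d1's `betaModel`/`nonnegModel` convention
`Γ_v = ℝ`), for `f ≠ 0`. [claim: Mochizuki2012, status: disputed] -/
theorem smul_smul_unitBall_subset_iff_log {f lam₁ lam₂ : K} (hf : f ≠ 0) (h₁ : lam₁ ≠ 0) (h₂ : lam₂ ≠ 0) :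
    f • (lam₁ • closedBall (0 : K) 1) ⊆ lam₂ • closedBall (0 : K) 1 ↔
      0 ≤ -Real.log ‖f‖ + -Real.log ‖lam₁‖ - -Real.log ‖lam₂‖ := by
  rw [smul_smul_unitBall_subset_iff f h₁ h₂]
  have hf' : 0 < ‖f‖ := norm_pos_iff.mpr hf
  have h₁' : 0 < ‖lam₁‖ := norm_pos_iff.mpr h₁
  have h₂' : 0 < ‖lam₂‖ := norm_pos_iff.mpr h₂
  rw [show -Real.log ‖f‖ + -Real.log ‖lam₁‖ - -Real.log ‖lam₂‖ = Real.log ‖lam₂‖ - Real.log (‖f‖ * ‖lam₁‖) by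
    rw [Real.log_mul hf'.ne' h₁'.ne']; ring]
  rw [sub_nonneg, Real.log_le_log_iff (mul_pos hf' h₁') h₂']

/-- **The dictionary in valuation form**: `f·𝔍_{1,v} ⊆ 𝔍_{2,v}` ⟺ `‖f λ₁ λ₂⁻¹‖ ≤ 1`, i.e. the class
`β_v(f) + [λ₁] − [λ₂]` is "nonnegative" = represented by an element of `𝒪_{K_v}`. [claim: Mochizuki2012, status: disputed] -/
theorem smul_smul_unitBall_subset_iff_norm_le_one (f : K) {lam₁ lam₂ : K} (h₁ : lam₁ ≠ 0) (h₂ : lam₂ ≠ 0) :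
    f • (lam₁ • closedBall (0 : K) 1) ⊆ lam₂ • closedBall (0 : K) 1 ↔ ‖f * lam₁ * lam₂⁻¹‖ ≤ 1 := by
  rw [smul_smul_unitBall_subset_iff f h₁ h₂, norm_mul, norm_mul, norm_inv,
    mul_inv_le_iff₀ (norm_pos_iff.mpr h₂), one_mul]

/-- **[IUTchIII] Ex. 3.6 (ii) tensor powers/products**: `(λ₁·𝒪)·(λ₂·𝒪) = (λ₁λ₂)·𝒪` as subsets of `K_v` (the
group law of `Γ_v`). [claim: Mochizuki2012, status: disputed] -/
theorem smul_unitBall_mul {lam₁ lam₂ : K} (h₁ : lam₁ ≠ 0) (h₂ : lam₂ ≠ 0) :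
    lam₁ • closedBall (0 : K) 1 * lam₂ • closedBall (0 : K) 1 = (lam₁ * lam₂) • closedBall (0 : K) 1 := by
  ext z
  rw [mem_smul_unitBall_iff (mul_ne_zero h₁ h₂), Set.mem_mul, norm_mul]
  constructor
  · rintro ⟨x, hx, y, hy, rfl⟩
    rw [mem_smul_unitBall_iff h₁] at hx
    rw [mem_smul_unitBall_iff h₂] at hy
    rw [norm_mul]
    exact mul_le_mul hx hy (norm_nonneg y) (norm_nonneg lam₁)
  · intro hz
    refine ⟨lam₁, self_mem_smul_closedBall lam₁, lam₁⁻¹ * z, (mem_smul_unitBall_iff h₂).mpr ?_, ?_⟩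
    · rw [norm_mul, norm_inv, inv_mul_le_iff₀ (norm_pos_iff.mpr h₁)]
      exact hz
    · rw [← mul_assoc, mul_inv_cancel₀ h₁, one_mul]

end NormedField

/-! ### Ultrametric places: `λ·𝒪_{K_v}` is an `𝒪_{K_v}`-submodule, and every finitely generated nonzero
`𝒪_{K_v}`-submodule of `K_v` is of this form -/

section Ultrametric

variable {K : Type*} [NontriviallyNormedField K] [IsUltrametricDist K]

/-- Mathlib's valuation subring of the norm IS `𝒪_{K_v} = {λ ∈ K_v | |λ| ≤ 1}` ([IUTchIII] Ex. 3.6 (ii)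
p. 107): membership. [claim: Mochizuki2012, status: disputed] -/
theorem mem_integer_iff_norm_le_one (x : K) :
    x ∈ (NormedField.valuation (K := K)).integer ↔ ‖x‖ ≤ 1 := by
  rw [Valuation.mem_integer_iff, NormedField.valuation_apply, ← NNReal.coe_le_coe, coe_nnnorm, NNReal.coe_one]

/-- As subsets of `K_v`: the valuation subring is the closed unit ball `𝒪_{K_v} = {λ ∈ K_v | |λ| ≤ 1}`
([IUTchIII] Ex. 3.6 (ii) p. 107). [claim: Mochizuki2012, status: disputed] -/
theorem coe_integer_eq_closedBall :
    ((NormedField.valuation (K := K)).integer : Set K) = closedBall (0 : K) 1 := by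
  ext x
  rw [SetLike.mem_coe, mem_integer_iff_norm_le_one, mem_closedBall, dist_zero_right]

/-- **`𝒪_{K_v}·λ = λ·𝒪_{K_v}`**: the cyclic `𝒪_{K_v}`-submodule of `K_v` generated by `λ` is, as a subset, the
local fractional ideal `λ·𝒪_{K_v}`. [claim: Mochizuki2012, status: disputed] -/
theorem coe_span_singleton_eq_smul_unitBall (lam : K) :
    ((Submodule.span (NormedField.valuation (K := K)).integer ({lam} : Set K) :
        Submodule (NormedField.valuation (K := K)).integer K) : Set K) = lam • closedBall (0 : K) 1 := by
  ext z
  rw [SetLike.mem_coe, Submodule.mem_span_singleton]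
  constructor
  · rintro ⟨a, rfl⟩
    refine mem_smul_set.mpr ⟨(a : K), ?_, ?_⟩
    · rw [mem_closedBall, dist_zero_right]; exact (mem_integer_iff_norm_le_one (a : K)).mp a.2
    · show lam * (a : K) = a • lam
      rw [Algebra.smul_def, mul_comm]; rfl
  · intro hz
    obtain ⟨a, ha, rfl⟩ := mem_smul_set.mp hz
    rw [mem_closedBall, dist_zero_right] at ha
    refine ⟨⟨a, (mem_integer_iff_norm_le_one a).mpr ha⟩, ?_⟩
    show _ = lam * a
    rw [Algebra.smul_def, mul_comm]; rfl

/-- The cyclic submodule generated by `λ ≠ 0` is nonzero. [folklore] -/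
private theorem span_singleton_ne_bot {lam : K} (hlam : lam ≠ 0) :
    (Submodule.span (NormedField.valuation (K := K)).integer ({lam} : Set K) :
      Submodule (NormedField.valuation (K := K)).integer K) ≠ ⊥ := by
  intro h
  have : lam ∈ (Submodule.span (NormedField.valuation (K := K)).integer ({lam} : Set K) :
      Submodule (NormedField.valuation (K := K)).integer K) := Submodule.subset_span rfl
  rw [h, Submodule.mem_bot] at this
  exact hlam this

/-- The cyclic submodule generated by `λ` is finitely generated. [folklore] -/
private theorem fg_span_singleton (lam : K) :
    (Submodule.span (NormedField.valuation (K := K)).integer ({lam} : Set K) :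
      Submodule (NormedField.valuation (K := K)).integer K).FG :=
  Submodule.fg_span (Set.finite_singleton lam)

/-- **[IUTchIII] Ex. 3.6 (ii), `v ∈ 𝕍^non`: "a finitely generated nonzero `𝒪_{K_v}`-submodule of `K_v`" IS
`λ·𝒪_{K_v}` for some `λ ≠ 0`** — a generator of maximal absolute value generates (valuation rings are Bézout).
This is the sentence "every nonzero finitely generated `𝒪_{K_v}`-submodule of `K_v` is of this form" of
abc-iut-L6-t6's `GlobalFrobenioidModels.lean` dictionary, PROVED. [claim: Mochizuki2012, status: disputed] -/
theorem exists_eq_smul_unitBall_of_fg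
    (J : Submodule (NormedField.valuation (K := K)).integer K) (hJ : J.FG) (hJ0 : J ≠ ⊥) :
    ∃ lam : K, lam ≠ 0 ∧ (J : Set K) = lam • closedBall (0 : K) 1 := by
  classical
  set O := (NormedField.valuation (K := K)).integer with hO
  obtain ⟨s, hs⟩ := hJ
  -- a nonzero generator exists
  have hne : ∃ y ∈ s, (y : K) ≠ 0 := by
    by_contra hcon
    apply hJ0
    rw [← hs, Submodule.span_eq_bot]
    intro y hy
    by_contra hy0
    exact hcon ⟨y, hy, hy0⟩
  obtain ⟨y₀, hy₀s, hy₀⟩ := hne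
  have hsne : s.Nonempty := ⟨y₀, hy₀s⟩
  -- a generator of maximal absolute value
  obtain ⟨x, hxs, hxmax⟩ := s.exists_max_image (fun y : K => ‖y‖) hsne
  have hx0 : x ≠ 0 := by
    intro hx
    have := hxmax y₀ hy₀s
    rw [hx, norm_zero] at this
    exact hy₀ (norm_le_zero_iff.mp this)
  refine ⟨x, hx0, ?_⟩
  -- `J = 𝒪·x`
  have hJx : J = Submodule.span O ({x} : Set K) := by
    rw [← hs]
    apply le_antisymm
    · rw [Submodule.span_le]
      intro y hy
      rw [SetLike.mem_coe, Submodule.mem_span_singleton]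
      -- `y = (y/x)·x` with `‖y/x‖ ≤ 1`
      have hyx : ‖y * x⁻¹‖ ≤ 1 := by
        rw [norm_mul, norm_inv, mul_inv_le_iff₀ (norm_pos_iff.mpr hx0), one_mul]
        exact hxmax y hy
      refine ⟨⟨y * x⁻¹, (mem_integer_iff_norm_le_one _).mpr hyx⟩, ?_⟩
      rw [Algebra.smul_def]
      show y * x⁻¹ * x = y
      rw [mul_assoc, inv_mul_cancel₀ hx0, mul_one]
    · exact Submodule.span_mono (Set.singleton_subset_iff.mpr hxs)
  rw [hJx]
  exact coe_span_singleton_eq_smul_unitBall x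

/-- Conversely every `λ·𝒪_{K_v}` (`λ ≠ 0`) underlies a finitely generated nonzero `𝒪_{K_v}`-submodule; so the
objects "finitely generated nonzero `𝒪_{K_v}`-submodule of `K_v`" of [IUTchIII] Ex. 3.6 (ii) at `v ∈ 𝕍^non` are
EXACTLY the sets `λ·𝒪_{K_v}`, `λ ∈ K_v^×`, i.e. the classes `[λ] ∈ Γ_v`. [claim: Mochizuki2012, status: disputed] -/
theorem fg_submodule_iff_smul_unitBall (S : Set K) :
    (∃ J : Submodule (NormedField.valuation (K := K)).integer K, J.FG ∧ J ≠ ⊥ ∧ (J : Set K) = S) ↔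
      ∃ lam : K, lam ≠ 0 ∧ S = lam • closedBall (0 : K) 1 := by
  constructor
  · rintro ⟨J, hfg, hne, rfl⟩
    exact exists_eq_smul_unitBall_of_fg J hfg hne
  · rintro ⟨lam, hlam, rfl⟩
    exact ⟨_, fg_span_singleton lam, span_singleton_ne_bot hlam, coe_span_singleton_eq_smul_unitBall lam⟩

end Ultrametric

end LocalFracIdeal

end Literature.IUT.LogThetaLattice

end
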